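import Mathlib

/-!
# Crux `HistoryTailL` (stmt-QuantumFields-19936), K2 organ of record «LOC-REG» (route crux `PoincareLipschitz.BlockLipschitzL`, stmt-QuantumFields-23533):
# THE LEUNG–XIN IDENTITY ON THE THREE-SPHERE — the summed second variation of a bond energy along the four conformal fields of `S³ ⊂ ℝ⁴`
# carries the energy with a NEGATIVE sign (`2 − n = −1` at `n = 3`)

Cell `ym3-torus` (YM ladder rung R3 = continuum SU(2) Yang–Mills on the three-torus — a RUNG, NOT the Clay problem: not d = 4, not infinite
volume, not a mass gap), LEAD seat `ym-ust-19936-w1` gen 8; `--supports stmt-QuantumFields-19936 --as helper`; THEOREMS ONLY, definition-free,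
imports Mathlib only (pure algebra in `ℝ⁴`).

WHY (LEAD rulings 2026-08-29T04:05Z/04:09Z on ★w2-19936 g11's LOCATE «LOC-REG = LEUNG–XIN», memo `F6-SOCKET-LOCATE-w2g11.md` §9).  The K2 organ is now
ONE a-priori row: at a box-ℓ²-orbit MINIMISER between two θ-good fields the perturbation one-form obeys an ABSOLUTE chart
`‖Y_k(b)‖ ≤ C·(r⁻¹ + θ_k·r²)` on every ball `B_r(b)` inside the reading set — no energy hypothesis.  Its mechanism is the stability theorem of
Xin (1980) / Leung (1982): stable harmonic maps into `Sⁿ`, `n ≥ 3`, are constant, because the second variation averaged over the `n+1` conformal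
(«tangential-coordinate») fields `v_a(y) = a − ⟨a, y⟩y` equals `(2 − n)∫η²|dφ|² + (gradient-of-cutoff terms)`.  Our target is `SU(2) ≅ S³` (`n = 3`);
the relative gauge `h` of the minimiser is a (twisted, lattice) harmonic map with bond energies `‖V_b − h_x W_b h_y*‖² = 2|h_x − Φ_b(h_y)|²`,
`Φ_b ∈ SO(4)`.  THIS FILE is the exact LATTICE form of the averaged second variation for ONE bond in the flat frame (the twist — transported frames
`a_x`, holonomy `O(θr²)` — is the consumer's): for unit `p, q ∈ ℝ⁴`, amplitudes `α, β` (the cutoff at the two ends) and `c = p·q`, `e = |p − q|² = 2 − 2c`,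

  `Σ_{a=1}^{4} [2αβ·v_a(p)·v_a(q) − c·(α²|v_a(p)|² + β²|v_a(q)|²)] = 2αβ(2 + c²) − 3c(α² + β²)`,   i.e.
  `Σ_a δ²_a |γ_p − γ_q|²  =  6c·(α − β)²  −  2αβ·e·(1 + e/2)`

— the ENERGY `e` enters NEGATIVELY: at a minimiser (Σ over bonds `≥ 0`, `α = η_x`, `β = η_y`) `Σ_b η_xη_y·e_b(1 + e_b/2) ≤ 3Σ_b c_b(η_x − η_y)²`, the
absolute local energy bound `E(B_{r/2}) ≲ r^{d−2}` from STABILITY ALONE (hole-filling/ε-regularity are the LOC-REG pen's next steps).  Also here: the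
normalised variation `γ_p(t) = (1 + t²α²|v|²)^{−1/2}(p + tαv)` stays on the sphere, and the FIRST-ORDER-FREE symmetric identity
`γ_p(t)·γ_q(t) + γ_p(−t)·γ_q(−t) = 2(c + t²αβ·v_a(p)·v_a(q)) / √((1 + t²α²|v_a(p)|²)(1 + t²β²|v_a(q)|²))`, so that a MINIMISER's comparison with the
two competitors `±t` needs no differentiation.

WHAT (ns `…Theorems.PoincareLipschitzLeungXinSphereIdentity`; vectors `Fin 4 → ℝ`, `x ⬝ᵥ y` the dot product, `e_a = Pi.single a 1`, everything spelled out).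
* §1 `single_dot`, `dot_single`, `sum_coord_mul_coord` (Parseval `Σ_a (e_a·x)(e_a·y) = x·y`), `tang_dot_self_pt` (`v_a(p) ⊥ p`).
* §2 ★ `sum_tang_dot_tang` (`Σ_a v_a(p)·v_a(q) = 2 + (p·q)²` for unit `p, q`), `sum_tang_normSq` (`= 3`).
* §3 ★★ `sum_bondHessian_eq` (the displayed identity) and ★★ `sum_secondVariation_eq` (the `6c(α−β)² − 2αβe(1+e/2)` form).
* §4 `varPt_dot_self` (on the sphere), ★ `varPt_dot_varPt_add_neg` (the first-order-free symmetric identity).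
HONEST SCOPE.  Finite-dimensional algebra; nothing of LOC-REG, the LP rows, `hG`, `BlockLipschitzL`, `HistoryTailL` or any summit statement is proved.
YM₃ on T³ is rung R3, NOT the Clay problem.

References: Y. L. Xin, Duke Math. J. **47** (1980) 609–613 (instability of harmonic maps from spheres; the conformal-field second variation);
P.-F. Leung, «On the stability of harmonic maps», Lecture Notes in Math. 949 (1982) 122–129 (targets `Sⁿ`, `n ≥ 3`); T. Bałaban, Commun. Math. Phys.
**98** (1985) 17–51 [Balaban1985Averaging] (§3, the regularity this organ replaces).
-/

set_option autoImplicit false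

open scoped BigOperators
open Finset

namespace Summit.QuantumFields.YangMills.Theorems.PoincareLipschitzLeungXinSphereIdentity

/-! ## §1 Coordinates and the tangential fields -/

/-- `e_a · x = x_a`. [folklore] -/
theorem single_dot (a : Fin 4) (x : Fin 4 → ℝ) : dotProduct (Pi.single a 1) x = x a := by
  rw [single_dotProduct, one_mul]

/-- `x · e_a = x_a`. [folklore] -/
theorem dot_single (x : Fin 4 → ℝ) (a : Fin 4) : dotProduct x (Pi.single a 1) = x a := by
  rw [dotProduct_single, mul_one]

/-- Parseval in `ℝ⁴`: `Σ_a (e_a·x)(e_a·y) = x·y`. [folklore] -/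
theorem sum_coord_mul_coord (x y : Fin 4 → ℝ) :
    ∑ a : Fin 4, dotProduct (Pi.single a 1) x * dotProduct (Pi.single a 1) y = dotProduct x y := by
  simp only [single_dot]
  rfl

/-- The tangential («conformal») field of the coordinate vector `e_a` at `y`: `v_a(y) = e_a − (e_a·y)·y`; its dot products, expanded.
`v_a(p)·w = w_a − p_a·(p·w)`. [folklore] -/
theorem tang_dot (a : Fin 4) (p w : Fin 4 → ℝ) :
    dotProduct (Pi.single a 1 - dotProduct (Pi.single a 1) p • p) w = w a - p a * dotProduct p w := by
  rw [sub_dotProduct, smul_dotProduct, single_dot, single_dot, smul_eq_mul]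

/-- `v_a(p) ⊥ p` for unit `p`. [folklore] -/
theorem tang_dot_self_pt (a : Fin 4) {p : Fin 4 → ℝ} (hp : dotProduct p p = 1) :
    dotProduct (Pi.single a 1 - dotProduct (Pi.single a 1) p • p) p = 0 := by
  rw [tang_dot, hp, mul_one, sub_self]

/-- `v_a(p)·v_a(q) = 1 − q_a² − p_a² + p_a·q_a·(p·q)` (any `p, q`; `e_a·e_a = 1`). [folklore] -/
theorem tang_dot_tang (a : Fin 4) (p q : Fin 4 → ℝ) :
    dotProduct (Pi.single a 1 - dotProduct (Pi.single a 1) p • p) (Pi.single a 1 - dotProduct (Pi.single a 1) q • q) =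
      1 - q a * q a - p a * p a + p a * q a * dotProduct p q := by
  rw [tang_dot, dotProduct_sub, dotProduct_smul, dot_single, smul_eq_mul]
  simp only [Pi.sub_apply, Pi.smul_apply, smul_eq_mul, single_dot, Pi.single_eq_same]
  ring

/-- `|v_a(p)|² = 1 − p_a²` for unit `p`. [folklore] -/
theorem tang_normSq (a : Fin 4) (p : Fin 4 → ℝ) (hp : dotProduct p p = 1) :
    dotProduct (Pi.single a 1 - dotProduct (Pi.single a 1) p • p) (Pi.single a 1 - dotProduct (Pi.single a 1) p • p) = 1 - p a * p a := by
  rw [tang_dot_tang a p p, hp]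
  ring

/-! ## §2 The two sphere sums -/

/-- `Σ_a x_a y_a = x·y` (the dot product unfolded over `Fin 4`). [folklore] -/
theorem sum_mul_eq_dot (x y : Fin 4 → ℝ) : ∑ a : Fin 4, x a * y a = dotProduct x y := rfl

/-- ★ **`Σ_a v_a(p)·v_a(q) = 2 + (p·q)²`** for unit `p, q ∈ ℝ⁴`. [cite: Xin1980, p.609–613; folklore algebra] -/
theorem sum_tang_dot_tang (p q : Fin 4 → ℝ) (hp : dotProduct p p = 1) (hq : dotProduct q q = 1) :
    ∑ a : Fin 4, dotProduct (Pi.single a 1 - dotProduct (Pi.single a 1) p • p) (Pi.single a 1 - dotProduct (Pi.single a 1) q • q) =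
      2 + dotProduct p q ^ 2 := by
  simp only [tang_dot_tang _ p q]
  have h1 : ∑ a : Fin 4, (1 - q a * q a - p a * p a + p a * q a * dotProduct p q) =
      4 - ∑ a : Fin 4, q a * q a - ∑ a : Fin 4, p a * p a + (∑ a : Fin 4, p a * q a) * dotProduct p q := by
    simp only [Finset.sum_add_distrib, Finset.sum_sub_distrib, Finset.sum_const, Finset.card_univ, Fintype.card_fin]
    rw [Finset.sum_mul]
    norm_num
  rw [h1, sum_mul_eq_dot, sum_mul_eq_dot, sum_mul_eq_dot, hp, hq]
  ring

/-- `Σ_a |v_a(p)|² = 3` for unit `p ∈ ℝ⁴` (the dimension `n = 3` of the sphere). [folklore] -/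
theorem sum_tang_normSq (p : Fin 4 → ℝ) (hp : dotProduct p p = 1) :
    ∑ a : Fin 4, dotProduct (Pi.single a 1 - dotProduct (Pi.single a 1) p • p) (Pi.single a 1 - dotProduct (Pi.single a 1) p • p) = 3 := by
  rw [sum_tang_dot_tang p p hp hp, hp]
  norm_num

/-! ## §3 The summed bond Hessian: the energy enters with the sign `2 − n = −1` -/

/-- ★★ **THE LEUNG–XIN BOND IDENTITY ON `S³`.**  For unit `p, q ∈ ℝ⁴`, reals `α, β` and `c = p·q`:
`Σ_a [2αβ·v_a(p)·v_a(q) − c·(α²|v_a(p)|² + β²|v_a(q)|²)] = 2αβ(2 + c²) − 3c(α² + β²)` — the sum over the four conformal fields of the second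
`t`-derivative at `0` of `γ_p^{αv_a}(t)·γ_q^{βv_a}(t)` (§4 gives the variation). [cite: Xin1980, p.609–613] -/
theorem sum_bondHessian_eq (p q : Fin 4 → ℝ) (hp : dotProduct p p = 1) (hq : dotProduct q q = 1) (α β : ℝ) :
    ∑ a : Fin 4, (2 * α * β * dotProduct (Pi.single a 1 - dotProduct (Pi.single a 1) p • p) (Pi.single a 1 - dotProduct (Pi.single a 1) q • q) -
        dotProduct p q * (α ^ 2 * dotProduct (Pi.single a 1 - dotProduct (Pi.single a 1) p • p) (Pi.single a 1 - dotProduct (Pi.single a 1) p • p) +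
          β ^ 2 * dotProduct (Pi.single a 1 - dotProduct (Pi.single a 1) q • q) (Pi.single a 1 - dotProduct (Pi.single a 1) q • q))) =
      2 * α * β * (2 + dotProduct p q ^ 2) - 3 * dotProduct p q * (α ^ 2 + β ^ 2) := by
  rw [Finset.sum_sub_distrib, ← Finset.mul_sum, sum_tang_dot_tang p q hp hq, ← Finset.mul_sum, Finset.sum_add_distrib, ← Finset.mul_sum,
    ← Finset.mul_sum, sum_tang_normSq p hp, sum_tang_normSq q hq]
  ring

/-- ★★ **THE SECOND-VARIATION FORM**: with `e = |p − q|² = 2 − 2c` the summed second variation of the bond energy `|γ_p − γ_q|² = 2 − 2γ_p·γ_q`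
along the four fields is `−2 × (§3's sum) = 6c(α − β)² − 2αβ·e·(1 + e/2)` — the cutoff-gradient term `6c(α−β)²` MINUS the energy term.
At a minimiser, summing over bonds: `Σ_b η_xη_y e_b(1 + e_b/2) ≤ 3Σ_b c_b(η_x − η_y)²`. [cite: Xin1980, p.609–613] -/
theorem sum_secondVariation_eq (p q : Fin 4 → ℝ) (hp : dotProduct p p = 1) (hq : dotProduct q q = 1) (α β : ℝ) :
    -2 * ∑ a : Fin 4, (2 * α * β * dotProduct (Pi.single a 1 - dotProduct (Pi.single a 1) p • p) (Pi.single a 1 - dotProduct (Pi.single a 1) q • q) -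
        dotProduct p q * (α ^ 2 * dotProduct (Pi.single a 1 - dotProduct (Pi.single a 1) p • p) (Pi.single a 1 - dotProduct (Pi.single a 1) p • p) +
          β ^ 2 * dotProduct (Pi.single a 1 - dotProduct (Pi.single a 1) q • q) (Pi.single a 1 - dotProduct (Pi.single a 1) q • q))) =
      6 * dotProduct p q * (α - β) ^ 2 -
        2 * α * β * dotProduct (p - q) (p - q) * (1 + dotProduct (p - q) (p - q) / 2) := by
  rw [sum_bondHessian_eq p q hp hq]
  have he : dotProduct (p - q) (p - q) = 2 - 2 * dotProduct p q := by
    rw [sub_dotProduct, dotProduct_sub, dotProduct_sub, hp, hq, dotProduct_comm q p]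
    ring
  rw [he]
  ring

/-! ## §4 The normalised variation and the first-order-free symmetric identity -/

/-- `|p + s·v|² = 1 + s²|v|²` for unit `p` and `v ⊥ p`. [folklore] -/
theorem dot_self_add_smul {p v : Fin 4 → ℝ} (hp : dotProduct p p = 1) (hv : dotProduct v p = 0) (s : ℝ) :
    dotProduct (p + s • v) (p + s • v) = 1 + s ^ 2 * dotProduct v v := by
  have hv' : dotProduct p v = 0 := by rw [dotProduct_comm]; exact hv
  rw [add_dotProduct, dotProduct_add, dotProduct_add, smul_dotProduct, dotProduct_smul, dotProduct_smul, smul_dotProduct, hp, hv, hv']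
  simp only [smul_eq_mul]
  ring

/-- **THE NORMALISED VARIATION STAYS ON THE SPHERE**: `γ(s) := (1 + s²|v|²)^{−1/2}·(p + s·v)` is a unit vector (`p` unit, `v ⊥ p`). [folklore] -/
theorem varPt_dot_self {p v : Fin 4 → ℝ} (hp : dotProduct p p = 1) (hv : dotProduct v p = 0) (s : ℝ) :
    dotProduct ((Real.sqrt (1 + s ^ 2 * dotProduct v v))⁻¹ • (p + s • v)) ((Real.sqrt (1 + s ^ 2 * dotProduct v v))⁻¹ • (p + s • v)) = 1 := by
  have hvv : 0 ≤ dotProduct v v := by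
    show 0 ≤ ∑ i, v i * v i
    exact Finset.sum_nonneg fun i _ => mul_self_nonneg (v i)
  have hD : 0 < 1 + s ^ 2 * dotProduct v v := by positivity
  rw [smul_dotProduct, dotProduct_smul, smul_eq_mul, smul_eq_mul, dot_self_add_smul hp hv s, ← mul_assoc,
    ← mul_inv, Real.mul_self_sqrt hD.le, inv_mul_cancel₀ hD.ne']

/-- ★ **THE FIRST-ORDER-FREE SYMMETRIC IDENTITY.**  For unit `p, q`, fields `v ⊥ p`, `w ⊥ q` and amplitudes folded into `v, w`:
`γ_p(s)·γ_q(s) + γ_p(−s)·γ_q(−s) = 2·(p·q + s²·v·w) / (√(1 + s²|v|²)·√(1 + s²|w|²))` — the odd terms cancel exactly, so comparing a MINIMISER with the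
two competitors `±s` isolates the second variation with no differentiation (`v := α·v_a(p)`, `w := β·v_a(q)`, then sum over `a` with §3).
[cite: Xin1980, p.609–613; folklore] -/
theorem varPt_dot_varPt_add_neg (p q v w : Fin 4 → ℝ) (s : ℝ) :
    dotProduct ((Real.sqrt (1 + s ^ 2 * dotProduct v v))⁻¹ • (p + s • v)) ((Real.sqrt (1 + s ^ 2 * dotProduct w w))⁻¹ • (q + s • w)) +
      dotProduct ((Real.sqrt (1 + (-s) ^ 2 * dotProduct v v))⁻¹ • (p + (-s) • v)) ((Real.sqrt (1 + (-s) ^ 2 * dotProduct w w))⁻¹ • (q + (-s) • w)) =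
      2 * (dotProduct p q + s ^ 2 * dotProduct v w) *
        ((Real.sqrt (1 + s ^ 2 * dotProduct v v))⁻¹ * (Real.sqrt (1 + s ^ 2 * dotProduct w w))⁻¹) := by
  rw [neg_sq]
  simp only [smul_dotProduct, dotProduct_smul, smul_eq_mul, add_dotProduct, dotProduct_add, neg_smul]
  simp only [dotProduct_neg, neg_dotProduct, smul_dotProduct, dotProduct_smul, smul_eq_mul]
  ring

end Summit.QuantumFields.YangMills.Theorems.PoincareLipschitzLeungXinSphereIdentity
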